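import Mathlib.LinearAlgebra.Dimension.Constructions
import Mathlib.LinearAlgebra.Dimension.Finrank
import Mathlib.LinearAlgebra.FiniteDimensional.Lemmas
import Literature.Computability.AlgebraicComplexity.OptimalDecompositionSliceSpan
import Literature.Computability.AlgebraicComplexity.TensorRankFactsProofs
import Literature.Computability.AlgebraicComplexity.LafonWinogradRankBound
import HarnessLib

/-!
# Hopcroft–Kerr's row lemma (1969/1971, Lemma 7): substitution with output credit

Topic `Literature/Computability/AlgebraicComplexity` (bilinear complexity; lower bounds for small
matrix multiplication formats).  Everything in this file is PROVED over an arbitrary field; there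
are no named facts and no new definitions.

## The printed statement

J. E. Hopcroft, L. R. Kerr, *On minimizing the number of multiplications necessary for matrix
multiplication*, Cornell CS Technical Report 69-44 (1969) = SIAM J. Appl. Math. 20 (1971) 30–36,
**Lemma 7** (TR p. 22): "Any algorithm `P` for `A × X` [`A` a `2 × 2`, `X` a `2 × n` matrix] which has
`k` multiplications of type `a₁₁α`, `a₁₂β`, and `(a₁₁+a₁₂)γ` has at least `3n + k/2`
multiplications."  Proof (TR pp. 22–23): the `n` outputs `a₁₁x₁ᵢ + a₁₂x₂ᵢ` of the first row span a
space `S` of dimension `n`, the `k` products span `M`, `dim (S ∩ M) ≤ k/2` (Winograd's column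
theorem), so `dim (S + M) ≥ n + k/2`; all of `S + M` vanishes under `a₁₁ = a₁₂ = 0`, and what is
left computes `a₂₁x₁ᵢ + a₂₂x₂ᵢ`, i.e. `⟨1,2,n⟩` of rank `2n`.  This is STRONGER than plain
substitution (`2n + k`): the killed outputs are credited too.

## What is proved here (the same argument, general form, in the tree's coordinates)

* `tensorRank_le_finrank_span_of_slice_mem` — a sharpening of BCS 1997 Prop. (14.45)(1)
  (`tensorRank_le_card_of_forall_slice_mem_span`): if every slice of `t` lies in the span of a
  finite family of rank-one matrices, then `R(t) ≤ dim` of that span (extract a basis).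
* `tensorRank_precomp_add_card_add_card_le` — **substitution with output credit**: for
  `t = ∑_{ρ ∈ σ} w_ρ ⊗ u_ρ ⊗ v_ρ`, a restriction `g` of the second index set killing the second
  factors `u_ρ`, `ρ ∈ D`, AND the slices `t a`, `a ∈ I` (linearly independent), one has
  `R(t ∘ (f × g × 1)) + |D| + |I| ≤ |σ| + q` whenever `dim (S ∩ M) ≤ q`, where `S = span {t a | a ∈ I}`
  and `M = span {u_ρ ⊗ v_ρ | ρ ∈ D}` (BCS 1997 Lemma (17.17)(A) is the case `I = ∅`, `q = 0`,
  `tensorRank_mapSecond_add_card_le`).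
* `hopcroftKerr1971_lemma7_row` — **the row lemma for `⟨m+1, p, n⟩`, `0 < p`**: for every
  decomposition of `matMulTensor K (m+1) p n` indexed by `σ` and every row `i₀` of the first
  matrix, if `D` is a set of indices whose second factors (the `X`-forms) are supported in row `i₀`,
  then `R(⟨m, p, n⟩) + n + |D| ≤ |σ| + |D| / p`.  For `(m+1, p) = (2, 2)` this is exactly the printed
  `3n + ⌈k/2⌉`; the general form is the same proof (our extrapolation, kernel-checked here, not a
  printed statement).  TODO(general form): rows are coordinate rows; an arbitrary row-combination
  `xᵀA` reduces to this by the sandwich symmetry (`MatMulSandwich*.lean`), not restated here.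
* `hopcroftKerr1971_lemma7_col` — the same for the `X`-forms supported in one COLUMN (via the
  symmetry `(A,B,C) ↦ (Aᵀ,Cᵀ,Bᵀ)`, `matMulTensor_swap_transpose_eq_sum`).
* `matMulTensor_three_row_card_le` / `…_col_…` — `⟨3,3,3⟩` over every field (`R(⟨2,3,3⟩) ≥ 14`):
  `17 + k ≤ |σ| + ⌊k/3⌋`; `matMulTensor_three_row_card_le_three` / `…_col_…` — with
  `R(⟨2,3,3⟩) ≥ 15` (true over `𝔽₂`, proved Summits-side) and `|σ| ≤ 20`: `k ≤ 3` per row and per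
  column (plain substitution: `k ≤ 5`).  Use: the integer-profile searches for `R_{𝔽₂}(⟨3,3,3⟩)`.

## References

* [HopcroftKerr1971] J. E. Hopcroft, L. R. Kerr, SIAM J. Appl. Math. 20 (1971) 30–36; preprint
  Cornell CS TR 69-44 (1969), Lemma 7 and its proof, pp. 22–23; Theorem 2 (Winograd) p. 17.
* [BurgisserClausenShokrollahi1997] P. Bürgisser, M. Clausen, M. A. Shokrollahi, *Algebraic
  Complexity Theory*, Springer 1997, Prop. (14.45)(1) and Lemma (17.17).
-/

noncomputable section

open scoped BigOperators

namespace Literature.Computability.AlgebraicComplexity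

namespace OptimalDecomposition

open Module Submodule

variable {K : Type*} [Field K]

/-! ## Rank is bounded by the dimension of a rank-one span containing the slices -/

/-- If every slice `t a` of a 3-tensor lies in the span of finitely many rank-one matrices
`u_ρ ⊗ v_ρ`, then `R(t)` is at most the DIMENSION of that span (choose a basis among the
`u_ρ ⊗ v_ρ` and apply BCS 1997 Prop. (14.45)(1)). [cite: BurgisserClausenShokrollahi1997, Prop. (14.45)(1)] -/
theorem tensorRank_le_finrank_span_of_slice_mem {ι κ μ σ : Type*} [Fintype ι] [Fintype κ]
    [Fintype μ] [Fintype σ] (t : ι → κ → μ → K) (u : σ → κ → K) (v : σ → μ → K)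
    (h : ∀ a, t a ∈ span K (Set.range fun ρ => (fun b c => u ρ b * v ρ c : κ → μ → K))) :
    tensorRank t ≤ finrank K (span K (Set.range fun ρ => (fun b c => u ρ b * v ρ c : κ → μ → K))) := by
  classical
  set x : σ → κ → μ → K := fun ρ b c => u ρ b * v ρ c with hx
  obtain ⟨B, hBs, hspan, hli⟩ := exists_linearIndependent K (Set.range x)
  have hBfin : B.Finite := (Set.finite_range x).subset hBs
  haveI : Fintype B := hBfin.fintype
  -- every element of `B` is some `x ρ`
  have hmem : ∀ y : B, ∃ ρ, x ρ = (y : κ → μ → K) := fun y => hBs y.2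
  choose r hr using hmem
  have hfam : (fun y : B => (fun b c => u (r y) b * v (r y) c : κ → μ → K)) =
      fun y : B => (y : κ → μ → K) := by
    funext y; exact hr y
  have hle := tensorRank_le_card_of_forall_slice_mem_span t (fun y : B => u (r y))
    (fun y : B => v (r y)) (fun a => by
      rw [hfam, Subtype.range_coe_subtype, Set.setOf_mem_eq, hspan]; exact h a)
  have hli' : LinearIndepOn K id B := hli
  have hcard : Fintype.card B = finrank K (span K (Set.range x)) := by
    rw [← hspan, finrank_span_set_eq_card hli', Set.toFinset_card]
  rw [← hcard]
  exact hle

/-! ## Substitution with output credit -/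

/-- **Substitution with output credit** (the mechanism of Hopcroft–Kerr 1971, Lemma 7, for an
arbitrary 3-tensor): let `t = ∑_{ρ∈σ} w_ρ ⊗ u_ρ ⊗ v_ρ`, let `g : κ' → κ` restrict the second index
set (and `f : ι' → ι` the first), let `D ⊆ σ` consist of indices whose second factor is killed
(`u_ρ ∘ g = 0`) and `I ⊆ ι` of slices that are killed (`(t a) ∘ (g × 1) = 0`) and linearly
independent; if `dim (span{t a | a ∈ I} ∩ span{u_ρ ⊗ v_ρ | ρ ∈ D}) ≤ q`, then
`R(t ∘ (f × g × 1)) + |D| + |I| ≤ |σ| + q`.  (All of `span{t a} + span{u_ρ ⊗ v_ρ}` — dimension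
`≥ |I| + dim M − q` — lies in the span `P` of the `|σ|` rank-one matrices and dies under `g`, so the
image of `P`, which contains the slices of the restricted tensor, has dimension
`≤ |σ| − |D| − |I| + q`.) [cite: HopcroftKerr1971, Lemma 7 (proof)] -/
theorem tensorRank_precomp_add_card_add_card_le {ι κ μ ι' κ' σ : Type*} [Fintype ι]
    [Fintype κ] [Fintype μ] [Fintype ι'] [Fintype κ'] [Fintype σ] [DecidableEq σ]
    {t : ι → κ → μ → K} {w : σ → ι → K} {u : σ → κ → K} {v : σ → μ → K}
    (ht : t = ∑ ρ, triad (w ρ) (u ρ) (v ρ)) (f : ι' → ι) (g : κ' → κ)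
    (D : Finset σ) (hD : ∀ ρ ∈ D, ∀ b', u ρ (g b') = 0)
    (I : Finset ι) (hI : ∀ a ∈ I, ∀ b' c, t a (g b') c = 0)
    (hind : LinearIndependent K (fun a : I => t (a : ι)))
    (q : ℕ)
    (hq : finrank K ↥(span K (Set.range fun a : I => t (a : ι)) ⊓
        span K (Set.range fun ρ : D => (fun b c => u ρ b * v ρ c : κ → μ → K))) ≤ q) :
    tensorRank (fun a' b' c => t (f a') (g b') c) + D.card + I.card ≤ Fintype.card σ + q := by
  classical
  -- the rank-one matrices, their span `P`, the killed slices `S`, the killed products `M`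
  set x : σ → κ → μ → K := fun ρ b c => u ρ b * v ρ c with hx
  set P : Submodule K (κ → μ → K) := span K (Set.range x) with hP
  set S : Submodule K (κ → μ → K) := span K (Set.range fun a : I => t (a : ι)) with hS
  set M : Submodule K (κ → μ → K) := span K (Set.range fun ρ : D => x ρ) with hM
  -- the restriction of the second index set, as a linear map on matrices
  let Φ : (κ → μ → K) →ₗ[K] (κ' → μ → K) := LinearMap.funLeft K (μ → K) g
  have hΦ : ∀ y : κ → μ → K, Φ y = fun b' => y (g b') := fun y => rfl
  -- `S ≤ P`, `M ≤ P`
  have hSP : S ≤ P := span_le.2 (by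
    rintro _ ⟨a, rfl⟩
    exact slice_mem_span_of_eq_sum_triad ht a)
  have hMP : M ≤ P := span_mono (by rintro _ ⟨ρ, rfl⟩; exact ⟨ρ, rfl⟩)
  -- `S` and `M` die under `Φ`
  have hSker : S ≤ LinearMap.ker Φ := span_le.2 (by
    rintro _ ⟨a, rfl⟩
    simp only [SetLike.mem_coe, LinearMap.mem_ker, hΦ]
    funext b' c
    exact hI a a.2 b' c)
  have hMker : M ≤ LinearMap.ker Φ := span_le.2 (by
    rintro _ ⟨ρ, rfl⟩
    simp only [SetLike.mem_coe, LinearMap.mem_ker, hΦ]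
    funext b' c
    simp [hx, hD ρ ρ.2 b'])
  -- rank–nullity for `Φ` restricted to `P`
  set Ψ : P →ₗ[K] (κ' → μ → K) := Φ ∘ₗ P.subtype with hΨ
  have hrn : finrank K (LinearMap.range Ψ) + finrank K (LinearMap.ker Ψ) = finrank K P :=
    LinearMap.finrank_range_add_finrank_ker Ψ
  have hrange : LinearMap.range Ψ = P.map Φ := by
    rw [hΨ, LinearMap.range_comp, Submodule.range_subtype]
  have hkerle : finrank K ↥(S ⊔ M) ≤ finrank K (LinearMap.ker Ψ) := by
    have hle : (S ⊔ M).comap P.subtype ≤ LinearMap.ker Ψ := by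
      intro y hy
      rw [LinearMap.mem_ker, hΨ, LinearMap.comp_apply, Submodule.subtype_apply]
      exact (sup_le hSker hMker) hy
    calc finrank K ↥(S ⊔ M)
        = finrank K ↥((S ⊔ M).comap P.subtype) :=
          (LinearEquiv.finrank_eq (Submodule.comapSubtypeEquivOfLe (sup_le hSP hMP))).symm
      _ ≤ finrank K (LinearMap.ker Ψ) := Submodule.finrank_mono hle
  -- `dim P ≤ dim M + (|σ| − |D|)`
  set M' : Submodule K (κ → μ → K) :=
    span K (Set.range fun ρ : ((Finset.univ : Finset σ) \ D : Finset σ) => x ρ) with hM'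
  have hPle : P ≤ M ⊔ M' := span_le.2 (by
    rintro _ ⟨ρ, rfl⟩
    by_cases hρ : ρ ∈ D
    · exact Submodule.mem_sup_left (subset_span ⟨⟨ρ, hρ⟩, rfl⟩)
    · refine Submodule.mem_sup_right (subset_span ⟨⟨ρ, ?_⟩, rfl⟩)
      simp [hρ])
  have hM'le : finrank K M' ≤ Fintype.card σ - D.card := by
    calc finrank K M' ≤ Fintype.card ↥((Finset.univ : Finset σ) \ D) := finrank_range_le_card _
      _ = Fintype.card σ - D.card := by rw [Fintype.card_coe, Finset.card_univ_sdiff]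
  have hPdim : finrank K P ≤ finrank K M + (Fintype.card σ - D.card) :=
    (Submodule.finrank_mono hPle).trans
      ((Submodule.finrank_add_le_finrank_add_finrank M M').trans (by omega))
  -- `dim (S ⊔ M) + dim (S ⊓ M) = |I| + dim M`
  have hsupinf : finrank K ↥(S ⊔ M) + finrank K ↥(S ⊓ M) = finrank K S + finrank K M :=
    Submodule.finrank_sup_add_finrank_inf_eq S M
  have hSdim : finrank K S = I.card := by
    rw [hS, finrank_span_eq_card hind, Fintype.card_coe]
  -- the restricted tensor's slices lie in `P.map Φ = span (Φ ∘ x)`, a span of rank-one matrices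
  have hmapspan : P.map Φ = span K (Set.range fun ρ => (fun b' c => u ρ (g b') * v ρ c :
      κ' → μ → K)) := by
    rw [hP, Submodule.map_span, ← Set.range_comp]
    rfl
  have hslices : ∀ a', (fun b' c => t (f a') (g b') c) ∈
      span K (Set.range fun ρ => (fun b' c => u ρ (g b') * v ρ c : κ' → μ → K)) := by
    intro a'
    rw [← hmapspan]
    exact Submodule.mem_map_of_mem
      (show t (f a') ∈ P from slice_mem_span_of_eq_sum_triad ht (f a'))
  have hR : tensorRank (fun a' b' c => t (f a') (g b') c) ≤ finrank K ↥(P.map Φ) := by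
    rw [hmapspan]
    exact tensorRank_le_finrank_span_of_slice_mem _ (fun ρ b' => u ρ (g b')) v hslices
  have hDle : D.card ≤ Fintype.card σ := Finset.card_le_univ D
  rw [← hrange] at hR
  omega

end OptimalDecomposition

/-! ## The row lemma for matrix multiplication -/

namespace HopcroftKerrRow

open Module Submodule OptimalDecomposition

variable {K : Type*} [Field K]

/-- The output slices of row `i₀` of `⟨m, p, n⟩`: the slice at output `(i₀, l)` is the matrix with
entry `1` at `((i₀, μ), (μ, l))` for every `μ` and `0` elsewhere. [cite: HopcroftKerr1971, Lemma 7 (proof: the set S')] -/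
theorem matMulTensor_slice_apply (m p n : ℕ) (a : Fin m × Fin n) (b : Fin m × Fin p)
    (c : Fin p × Fin n) :
    matMulTensor K m p n a b c = if a.1 = b.1 ∧ b.2 = c.1 ∧ a.2 = c.2 then 1 else 0 := rfl

/-- Dropping row `i₀` of the first matrix (in the output slot and in the `X` slot) turns
`⟨m+1, p, n⟩` into `⟨m, p, n⟩`. [cite: HopcroftKerr1971, Lemma 7 (proof: "set a₁₁ = a₁₂ = 0")] -/
theorem matMulTensor_precomp_succAbove (m p n : ℕ) (i₀ : Fin (m + 1)) :
    (fun (a' : Fin m × Fin n) (b' : Fin m × Fin p) (c : Fin p × Fin n) =>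
      matMulTensor K (m + 1) p n (i₀.succAbove a'.1, a'.2) (i₀.succAbove b'.1, b'.2) c) =
      matMulTensor K m p n := by
  funext a' b' c
  simp only [matMulTensor, Fin.succAbove_right_inj]

/-- The `n` output slices of a fixed row `i₀` are linearly independent (`0 < p`).
[cite: HopcroftKerr1971, Lemma 7 (proof: "Clearly S has dimension n")] -/
theorem linearIndependent_slices_row {m p n : ℕ} (hp : 0 < p) (i₀ : Fin m) :
    LinearIndependent K (fun l : Fin n => matMulTensor K m p n (i₀, l)) := by
  rw [Fintype.linearIndependent_iff]
  intro g hg l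
  have h := congr_fun (congr_fun hg (i₀, ⟨0, hp⟩)) (⟨0, hp⟩, l)
  simp only [Finset.sum_apply, Pi.smul_apply, matMulTensor, smul_eq_mul, Pi.zero_apply] at h
  rw [Finset.sum_eq_single l] at h
  · simpa using h
  · intro l' _ hl'
    simp [hl']
  · simp

/-- Rows of members of `L` lie in the "row space" `⨆_b L.map (proj b)` (proof device for HK's use of
Winograd's Theorem 2). [folklore] -/
private theorem row_mem_rowSpan {κ μ : Type*} (L : Submodule K (κ → μ → K)) {y : κ → μ → K}
    (hy : y ∈ L) (b : κ) :
    y b ∈ ⨆ b' : κ, L.map (LinearMap.proj b' : (κ → μ → K) →ₗ[K] (μ → K)) :=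
  (le_iSup (fun b' : κ => L.map (LinearMap.proj b' : (κ → μ → K) →ₗ[K] (μ → K))) b)
    (Submodule.mem_map_of_mem (f := (LinearMap.proj b : (κ → μ → K) →ₗ[K] (μ → K))) hy)

/-- The rows of the span of rank-one matrices `u_ρ ⊗ v_ρ` lie in the span of the `v_ρ`. [folklore] -/
private theorem rowSpan_span_rankOne_le {κ μ σ : Type*} (u : σ → κ → K) (v : σ → μ → K) :
    (⨆ b : κ, (span K (Set.range fun ρ => (fun b c => u ρ b * v ρ c : κ → μ → K))).map
      (LinearMap.proj b : (κ → μ → K) →ₗ[K] (μ → K))) ≤ span K (Set.range v) := by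
  refine iSup_le fun b => ?_
  rw [Submodule.map_span, Submodule.span_le]
  rintro _ ⟨_, ⟨ρ, rfl⟩, rfl⟩
  have : (LinearMap.proj b : (κ → μ → K) →ₗ[K] (μ → K)) (fun b c => u ρ b * v ρ c) = u ρ b • v ρ := by
    funext c; simp [LinearMap.proj_apply]
  rw [SetLike.mem_coe, this]
  exact Submodule.smul_mem _ _ (subset_span ⟨ρ, rfl⟩)

/-- The row `(i₀, μ₀)` of the combination `∑_l c_l · (slice (i₀, l))` of output slices of row `i₀` of
`⟨m, p, n⟩` is the vector `e_{μ₀} ⊗ c`. [cite: HopcroftKerr1971, Lemma 7 (proof)] -/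
theorem row_sum_slices {m p n : ℕ} (i₀ : Fin m) (c : Fin n → K) (μ₀ : Fin p) :
    (∑ l, c l • matMulTensor K m p n (i₀, l)) (i₀, μ₀) =
      fun d : Fin p × Fin n => if d.1 = μ₀ then c d.2 else 0 := by
  funext d
  simp only [Finset.sum_apply, Pi.smul_apply, matMulTensor, smul_eq_mul, true_and]
  rw [Finset.sum_eq_single d.2]
  · by_cases h : d.1 = μ₀
    · simp [h]
    · have h' : ¬ μ₀ = d.1 := fun e => h e.symm
      simp [h, h']
  · intro l _ hl
    simp [hl]
  · simp

/-- **The overlap bound** (HK's use of Winograd's Theorem 2): inside the span `S` of the output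
slices of row `i₀` of `⟨m, p, n⟩`, every subspace `L` has row space of dimension `≥ p · dim L`;
hence for `L ⊆ S ∩ M`, `M` spanned by `|D|` rank-one matrices, `p · dim L ≤ |D|`.
[cite: HopcroftKerr1971, Lemma 7 (proof: "S ∩ M has dimension less than or equal to k/2")] -/
theorem mul_finrank_inf_le_card {m p n : ℕ} {σ : Type*} [Fintype σ] (i₀ : Fin m)
    (u : σ → Fin m × Fin p → K) (v : σ → Fin p × Fin n → K) (D : Finset σ) :
    p * finrank K ↥(span K (Set.range fun l : Fin n => matMulTensor K m p n (i₀, l)) ⊓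
        span K (Set.range fun ρ : D => (fun b c => u ρ b * v ρ c :
          Fin m × Fin p → Fin p × Fin n → K))) ≤ D.card := by
  classical
  set S : Submodule K (Fin m × Fin p → Fin p × Fin n → K) :=
    span K (Set.range fun l : Fin n => matMulTensor K m p n (i₀, l)) with hS
  set M : Submodule K (Fin m × Fin p → Fin p × Fin n → K) :=
    span K (Set.range fun ρ : D => (fun b c => u ρ b * v ρ c :
      Fin m × Fin p → Fin p × Fin n → K)) with hM
  set L := S ⊓ M with hL
  -- the combination map `c ↦ ∑ c_l · slice l` and the pull-back `C` of `L`
  let X : (Fin n → K) →ₗ[K] (Fin m × Fin p → Fin p × Fin n → K) :=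
    Fintype.linearCombination K (fun l : Fin n => matMulTensor K m p n (i₀, l))
  have hXapply : ∀ c, X c = ∑ l, c l • matMulTensor K m p n (i₀, l) := fun c =>
    Fintype.linearCombination_apply K _ c
  have hXrange : LinearMap.range X = S := by
    rw [hS, Fintype.range_linearCombination]
  set C : Submodule K (Fin n → K) := L.comap X with hC
  -- `L = C.map X` (since `L ≤ S = range X`), so `dim C ≥ dim L`
  have hLle : L ≤ C.map X := by
    intro y hy
    have hyS : y ∈ LinearMap.range X := by rw [hXrange]; exact inf_le_left (a := S) (b := M) hy
    obtain ⟨c, rfl⟩ := hyS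
    exact ⟨c, hy, rfl⟩
  have hdimL : finrank K L ≤ finrank K C :=
    (Submodule.finrank_mono hLle).trans (Submodule.finrank_map_le X C)
  -- the map `d ↦ (μ, ν) ↦ d μ ν` from `Fin p → C` into the row space of `L`
  let Θ : (Fin p → ↥C) →ₗ[K] (Fin p × Fin n → K) :=
    { toFun := fun d e => ((d e.1 : ↥C) : Fin n → K) e.2
      map_add' := fun d d' => by funext e; simp
      map_smul' := fun r d => by funext e; simp }
  have hΘinj : Function.Injective Θ := by
    intro d d' h
    funext μ₀
    apply Subtype.ext
    funext ν
    exact congr_fun h (μ₀, ν)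
  have hΘle : LinearMap.range Θ ≤ ⨆ b : Fin m × Fin p, L.map
      (LinearMap.proj b : (Fin m × Fin p → Fin p × Fin n → K) →ₗ[K] (Fin p × Fin n → K)) := by
    rintro _ ⟨d, rfl⟩
    -- `Θ d = ∑_μ (row (i₀, μ) of X (d μ))`
    have hrow : ∀ (c : Fin n → K) (μ₀ : Fin p), (X c) (i₀, μ₀) =
        fun e : Fin p × Fin n => if e.1 = μ₀ then c e.2 else 0 := fun c μ₀ => by
      rw [hXapply]; exact row_sum_slices i₀ c μ₀
    have hdec : Θ d = ∑ μ₀ : Fin p, (X (d μ₀ : Fin n → K)) (i₀, μ₀) := by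
      funext e
      rw [Finset.sum_apply]
      simp_rw [hrow]
      rw [Finset.sum_eq_single e.1]
      · simp only [if_true]
        rfl
      · intro μ₀ _ hne
        have hne' : e.1 ≠ μ₀ := fun h => hne h.symm
        simp [hne']
      · simp
    rw [hdec]
    refine Submodule.sum_mem _ fun μ₀ _ => row_mem_rowSpan L ?_ (i₀, μ₀)
    exact (d μ₀).2
  -- dimension count
  have h1 : p * finrank K C = finrank K (Fin p → ↥C) := by
    rw [Module.finrank_pi_fintype, Finset.sum_const, Finset.card_univ, Fintype.card_fin,
      smul_eq_mul]
  have h2 : finrank K (Fin p → ↥C) = finrank K (LinearMap.range Θ) :=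
    (LinearMap.finrank_range_of_inj hΘinj).symm
  have hmono : (⨆ b : Fin m × Fin p, L.map
      (LinearMap.proj b : (Fin m × Fin p → Fin p × Fin n → K) →ₗ[K] (Fin p × Fin n → K))) ≤
      ⨆ b : Fin m × Fin p, M.map
        (LinearMap.proj b : (Fin m × Fin p → Fin p × Fin n → K) →ₗ[K] (Fin p × Fin n → K)) :=
    iSup_mono fun _ => Submodule.map_mono inf_le_right
  have h3 : finrank K (LinearMap.range Θ) ≤ finrank K ↥(⨆ b : Fin m × Fin p, M.map
      (LinearMap.proj b : (Fin m × Fin p → Fin p × Fin n → K) →ₗ[K] (Fin p × Fin n → K))) :=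
    Submodule.finrank_mono (hΘle.trans hmono)
  have h4 : finrank K ↥(⨆ b : Fin m × Fin p, M.map
      (LinearMap.proj b : (Fin m × Fin p → Fin p × Fin n → K) →ₗ[K] (Fin p × Fin n → K))) ≤
      D.card := by
    calc finrank K ↥(⨆ b : Fin m × Fin p, M.map
          (LinearMap.proj b : (Fin m × Fin p → Fin p × Fin n → K) →ₗ[K] (Fin p × Fin n → K)))
          ≤ finrank K (span K (Set.range fun ρ : D => v ρ)) :=
          Submodule.finrank_mono (rowSpan_span_rankOne_le (fun ρ : D => u ρ) (fun ρ : D => v ρ))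
      _ ≤ Fintype.card D := finrank_range_le_card _
      _ = D.card := Fintype.card_coe D
  calc p * finrank K L ≤ p * finrank K C := Nat.mul_le_mul_left p hdimL
    _ ≤ D.card := by rw [h1, h2]; exact h3.trans h4

/-- **Hopcroft–Kerr 1971, Lemma 7 — general row form.**  Let `∑_{ρ ∈ σ} w_ρ ⊗ u_ρ ⊗ v_ρ` be any
decomposition of the matrix multiplication tensor `⟨m+1, p, n⟩` (`0 < p`; `u_ρ` = the linear forms
in the first matrix `A`, `v_ρ` those in the second), `i₀` a row of `A`, and `D` a set of indices
whose `A`-forms are supported in row `i₀` (`u_ρ (κ, μ) = 0` for `κ ≠ i₀`). Then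
`R(⟨m, p, n⟩) + n + |D| ≤ |σ| + ⌊|D| / p⌋`.
Printed case (`m + 1 = p = 2`, any field — HK work over GF(2)): `|σ| ≥ R(⟨1,2,n⟩) + n + ⌈k/2⌉ =
3n + ⌈k/2⌉` ("has at least `3n + k/2` multiplications").  The general form is the verbatim
generalisation of HK's proof (their Winograd step = `mul_finrank_inf_le_card`); it is not printed
as such. [cite: HopcroftKerr1971, Lemma 7] -/
theorem hopcroftKerr1971_lemma7_row {m p n : ℕ} (hp : 0 < p) {σ : Type*} [Fintype σ]
    [DecidableEq σ] {w : σ → Fin (m + 1) × Fin n → K} {u : σ → Fin (m + 1) × Fin p → K}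
    {v : σ → Fin p × Fin n → K}
    (ht : matMulTensor K (m + 1) p n = ∑ ρ, triad (w ρ) (u ρ) (v ρ)) (i₀ : Fin (m + 1))
    (D : Finset σ) (hD : ∀ ρ ∈ D, ∀ b : Fin (m + 1) × Fin p, b.1 ≠ i₀ → u ρ b = 0) :
    tensorRank (matMulTensor K m p n) + n + D.card ≤ Fintype.card σ + D.card / p := by
  classical
  -- the killed slices: the `n` outputs of row `i₀`
  set I : Finset (Fin (m + 1) × Fin n) := Finset.univ.image fun l : Fin n => (i₀, l) with hI
  have hIcard : I.card = n := by
    rw [hI, Finset.card_image_of_injective _ (fun l l' h => (Prod.ext_iff.1 h).2), Finset.card_univ,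
      Fintype.card_fin]
  have hmemI : ∀ a ∈ I, a.1 = i₀ := by
    intro a ha
    obtain ⟨l, -, rfl⟩ := Finset.mem_image.1 ha
    rfl
  -- linear independence of the killed slices, as a family indexed by `I`
  have hind : LinearIndependent K (fun a : I => matMulTensor K (m + 1) p n (a : Fin (m + 1) × Fin n)) := by
    let e : Fin n ≃ I :=
      { toFun := fun l => ⟨(i₀, l), Finset.mem_image.2 ⟨l, Finset.mem_univ _, rfl⟩⟩
        invFun := fun a => (a : Fin (m + 1) × Fin n).2
        left_inv := fun l => rfl
        right_inv := fun a => by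
          apply Subtype.ext
          exact Prod.ext (hmemI a a.2).symm rfl }
    have h0 := linearIndependent_slices_row (K := K) (m := m + 1) (n := n) hp i₀
    have : (fun a : I => matMulTensor K (m + 1) p n (a : Fin (m + 1) × Fin n)) ∘ e =
        fun l : Fin n => matMulTensor K (m + 1) p n (i₀, l) := by
      funext l; rfl
    rw [← linearIndependent_equiv e, this]
    exact h0
  -- overlap bound, transported along `I ≃ Fin n`
  have hq : finrank K ↥(span K (Set.range fun a : I =>
        matMulTensor K (m + 1) p n (a : Fin (m + 1) × Fin n)) ⊓
      span K (Set.range fun ρ : D => (fun b c => u ρ b * v ρ c :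
        Fin (m + 1) × Fin p → Fin p × Fin n → K))) ≤ D.card / p := by
    have hrange : (Set.range fun a : I => matMulTensor K (m + 1) p n (a : Fin (m + 1) × Fin n)) =
        Set.range fun l : Fin n => matMulTensor K (m + 1) p n (i₀, l) := by
      ext y
      constructor
      · rintro ⟨a, rfl⟩
        obtain ⟨l, -, hl⟩ := Finset.mem_image.1 a.2
        refine ⟨l, ?_⟩
        show matMulTensor K (m + 1) p n (i₀, l) = matMulTensor K (m + 1) p n a
        rw [hl]
      · rintro ⟨l, rfl⟩
        exact ⟨⟨(i₀, l), Finset.mem_image.2 ⟨l, Finset.mem_univ _, rfl⟩⟩, rfl⟩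
    rw [hrange, Nat.le_div_iff_mul_le hp, mul_comm]
    exact mul_finrank_inf_le_card i₀ u v D
  -- substitution with output credit, along the maps dropping row `i₀`
  have hmain := tensorRank_precomp_add_card_add_card_le ht
    (fun a' : Fin m × Fin n => ((i₀.succAbove a'.1, a'.2) : Fin (m + 1) × Fin n))
    (fun b' : Fin m × Fin p => ((i₀.succAbove b'.1, b'.2) : Fin (m + 1) × Fin p))
    D (fun ρ hρ b' => hD ρ hρ _ (Fin.succAbove_ne i₀ b'.1))
    I (fun a ha b' c => by
      have h1 : a.1 ≠ i₀.succAbove b'.1 := by rw [hmemI a ha]; exact (Fin.succAbove_ne i₀ b'.1).symm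
      simp [matMulTensor, h1])
    hind (D.card / p) hq
  rw [matMulTensor_precomp_succAbove, hIcard] at hmain
  omega

/-! ## The column version (via the symmetry `(A, B, C) ↦ (Aᵀ, Cᵀ, Bᵀ)`) and the `⟨3,3,3⟩` caps -/

/-- Swapping the output slot with the `Y` slot and transposing the `X` index turns `⟨k, m, n⟩` into
`⟨m, k, n⟩` (the symmetry `(A,B,C) ↦ (Aᵀ,Cᵀ,Bᵀ)` of matrix multiplication in the tree's output-first
coordinates). [cite: HopcroftKerr1971, Lemma 7 (Corollary: "by transformations we also have similar theorems")] -/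
theorem matMulTensor_swap_transpose (k m n : ℕ) :
    matMulTensor K m k n = fun (a' : Fin m × Fin n) (b' : Fin m × Fin k) (c' : Fin k × Fin n) =>
      matMulTensor K k m n c' b'.swap a' := by
  funext a' b' c'
  simp only [matMulTensor, Prod.fst_swap, Prod.snd_swap]
  by_cases h : (c'.1 = b'.2 ∧ b'.1 = a'.1 ∧ c'.2 = a'.2)
  · have h' : a'.1 = b'.1 ∧ b'.2 = c'.1 ∧ a'.2 = c'.2 := ⟨h.2.1.symm, h.1.symm, h.2.2.symm⟩
    rw [if_pos h', if_pos h]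
  · have h' : ¬ (a'.1 = b'.1 ∧ b'.2 = c'.1 ∧ a'.2 = c'.2) :=
      fun hh => h ⟨hh.2.1.symm, hh.1.symm, hh.2.2.symm⟩
    rw [if_neg h', if_neg h]

/-- A decomposition of `⟨k, m, n⟩` yields one of `⟨m, k, n⟩` of the same length whose first-matrix
forms are the TRANSPOSED `X`-forms. [cite: HopcroftKerr1971, Lemma 7 (Corollary)] -/
theorem matMulTensor_swap_transpose_eq_sum {k m n : ℕ} {σ : Type*} [Fintype σ]
    {w : σ → Fin k × Fin n → K} {u : σ → Fin k × Fin m → K} {v : σ → Fin m × Fin n → K}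
    (ht : matMulTensor K k m n = ∑ ρ, triad (w ρ) (u ρ) (v ρ)) :
    matMulTensor K m k n = ∑ ρ, triad (v ρ) (fun b' : Fin m × Fin k => u ρ b'.swap) (w ρ) := by
  rw [matMulTensor_swap_transpose, ht]
  funext a' b' c'
  simp only [Finset.sum_apply, triad_apply]
  exact Finset.sum_congr rfl fun ρ _ => by ring

/-- **Hopcroft–Kerr 1971, Lemma 7 — column form** (for the `X`-forms supported in one COLUMN `j₀` of
the first matrix of `⟨k, m+1, n⟩`, `0 < k`): `R(⟨m, k, n⟩) + n + |D| ≤ |σ| + ⌊|D| / k⌋`.  Obtained from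
the row form through the symmetry `(A,B,C) ↦ (Aᵀ,Cᵀ,Bᵀ)`; HK print only the row statements (for
`2×2` by `2×n`, `n ≠ 2`, there is no such symmetry). [cite: HopcroftKerr1971, Lemma 7 (Corollary)] -/
theorem hopcroftKerr1971_lemma7_col {k m n : ℕ} (hk : 0 < k) {σ : Type*} [Fintype σ]
    [DecidableEq σ] {w : σ → Fin k × Fin n → K} {u : σ → Fin k × Fin (m + 1) → K}
    {v : σ → Fin (m + 1) × Fin n → K}
    (ht : matMulTensor K k (m + 1) n = ∑ ρ, triad (w ρ) (u ρ) (v ρ)) (j₀ : Fin (m + 1))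
    (D : Finset σ) (hD : ∀ ρ ∈ D, ∀ b : Fin k × Fin (m + 1), b.2 ≠ j₀ → u ρ b = 0) :
    tensorRank (matMulTensor K m k n) + n + D.card ≤ Fintype.card σ + D.card / k :=
  hopcroftKerr1971_lemma7_row hk (matMulTensor_swap_transpose_eq_sum ht) j₀ D
    (fun ρ hρ b' hb' => hD ρ hρ b'.swap hb')

/-- **`⟨3,3,3⟩`, every field**: with `R(⟨2,3,3⟩) ≥ 14` (Lafon–Winograd; tree
`fourteen_le_tensorRank_matMulTensor_233`), a decomposition of length `|σ|` has, for every row `i₀`,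
`17 + k ≤ |σ| + ⌊k/3⌋` where `k` counts the terms whose `X`-form is supported in row `i₀`; likewise for
columns. [cite: HopcroftKerr1971, Lemma 7] -/
theorem matMulTensor_three_row_card_le {σ : Type*} [Fintype σ] [DecidableEq σ]
    {w : σ → Fin 3 × Fin 3 → K} {u : σ → Fin 3 × Fin 3 → K} {v : σ → Fin 3 × Fin 3 → K}
    (ht : matMulTensor K 3 3 3 = ∑ ρ, triad (w ρ) (u ρ) (v ρ)) (i₀ : Fin 3) (D : Finset σ)
    (hD : ∀ ρ ∈ D, ∀ b : Fin 3 × Fin 3, b.1 ≠ i₀ → u ρ b = 0) :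
    17 + D.card ≤ Fintype.card σ + D.card / 3 := by
  have h := hopcroftKerr1971_lemma7_row (m := 2) (p := 3) (n := 3) (by norm_num) ht i₀ D hD
  have h14 := fourteen_le_tensorRank_matMulTensor_233 K
  omega

/-- The column companion of `matMulTensor_three_row_card_le`. [cite: HopcroftKerr1971, Lemma 7] -/
theorem matMulTensor_three_col_card_le {σ : Type*} [Fintype σ] [DecidableEq σ]
    {w : σ → Fin 3 × Fin 3 → K} {u : σ → Fin 3 × Fin 3 → K} {v : σ → Fin 3 × Fin 3 → K}
    (ht : matMulTensor K 3 3 3 = ∑ ρ, triad (w ρ) (u ρ) (v ρ)) (j₀ : Fin 3) (D : Finset σ)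
    (hD : ∀ ρ ∈ D, ∀ b : Fin 3 × Fin 3, b.2 ≠ j₀ → u ρ b = 0) :
    17 + D.card ≤ Fintype.card σ + D.card / 3 := by
  have h := hopcroftKerr1971_lemma7_col (k := 3) (m := 2) (n := 3) (by norm_num) ht j₀ D hD
  have h14 := fourteen_le_tensorRank_matMulTensor_233 K
  omega

/-- **The cap for a hypothetical short scheme of `⟨3,3,3⟩`.**  If `R(⟨2,3,3⟩) ≥ 15` over `K` (true
over `𝔽₂`: Hopcroft–Kerr 1971 Thm 6, kernel theorem `le_tensorRank_matMulTensor_233_gf2` on the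
Summits side) and `⟨3,3,3⟩` has a decomposition of length `|σ| ≤ 20`, then at most **3** of its terms
have their `X`-form supported in any one row, and at most 3 in any one column (plain substitution
gives only `≤ 5`). [cite: HopcroftKerr1971, Lemma 7] -/
theorem matMulTensor_three_row_card_le_three {σ : Type*} [Fintype σ] [DecidableEq σ]
    (h15 : 15 ≤ tensorRank (matMulTensor K 2 3 3))
    {w : σ → Fin 3 × Fin 3 → K} {u : σ → Fin 3 × Fin 3 → K} {v : σ → Fin 3 × Fin 3 → K}
    (ht : matMulTensor K 3 3 3 = ∑ ρ, triad (w ρ) (u ρ) (v ρ)) (hσ : Fintype.card σ ≤ 20)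
    (i₀ : Fin 3) (D : Finset σ) (hD : ∀ ρ ∈ D, ∀ b : Fin 3 × Fin 3, b.1 ≠ i₀ → u ρ b = 0) :
    D.card ≤ 3 := by
  have h := hopcroftKerr1971_lemma7_row (m := 2) (p := 3) (n := 3) (by norm_num) ht i₀ D hD
  omega

/-- Column companion of `matMulTensor_three_row_card_le_three`. [cite: HopcroftKerr1971, Lemma 7] -/
theorem matMulTensor_three_col_card_le_three {σ : Type*} [Fintype σ] [DecidableEq σ]
    (h15 : 15 ≤ tensorRank (matMulTensor K 2 3 3))
    {w : σ → Fin 3 × Fin 3 → K} {u : σ → Fin 3 × Fin 3 → K} {v : σ → Fin 3 × Fin 3 → K}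
    (ht : matMulTensor K 3 3 3 = ∑ ρ, triad (w ρ) (u ρ) (v ρ)) (hσ : Fintype.card σ ≤ 20)
    (j₀ : Fin 3) (D : Finset σ) (hD : ∀ ρ ∈ D, ∀ b : Fin 3 × Fin 3, b.2 ≠ j₀ → u ρ b = 0) :
    D.card ≤ 3 := by
  have h := hopcroftKerr1971_lemma7_col (k := 3) (m := 2) (n := 3) (by norm_num) ht j₀ D hD
  omega

end HopcroftKerrRow

end Literature.Computability.AlgebraicComplexity
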